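import Summits.AtomisticToContinuum.HydrodynamicLimit.Theses.CollisionIsometryCLT

/-!
# Line `superexp-entropy-transfer` for crux `DiffuseBackwardInfluence` (stmt-AtomisticToContinuum-12950)

Route `CollisionIsometryCLT`, sub-problem `HydrodynamicLimit`.  Skeleton line (crux-plan): five registered
stubs `stub_*`, the sorry-free statement-level composition `cruxConclusion_of_statements` (stub STATEMENTS ⇒
the crux's conclusion at every `0 < σ < 1/2`), and the skeleton theorem `DiffuseBackwardInfluence_of`
concluding the crux decl BY NAME from the five stubs (no other `sorry`).

Idea (card `superexp-entropy-transfer` ≈ `entropy-transfer-equilibrium-superexp`, triage r1-1 pass): the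
local Gibbs law `P_N` has relative entropy `O(N)` with respect to the HOMOGENEOUS Gibbs law at rest `G_N`
(`eqLaw`), and `G_N` is invariant under every hard-sphere flow (Liouville + energy conservation).  The crux
functional `ipr ∈ [9/(N+1), 9]` is BOUNDED, so the entropy inequality (Kipnis–Landim App. 1 Prop. 8.2, here via
the tree's `Literature.Probability.Divergences.integral_le_toReal_klDiv_add_integral`)
`P[A] · log(1 + 1/G[A]) ≤ 1 + H(P | G)` transfers the NON-equilibrium statement to an EQUILIBRIUM one at
super-exponential precision: `G_N{ipr > δ} ≤ e^{-c(N+1)}` for every `c` (speed ≫ N; the window's `n_N → ∞`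
collisions per particle supply speed `N log n_N`, tight by the comoving-cold-cluster / layered-gas scenarios).
The equilibrium estimate is cut into its two halves: few-collision particles are super-exponentially rare
(`stub_fewCollisionsSuperExp`, the ballistic-tubes half: a static large deviation for velocity coherence) and,
given that most particles collide `m_N → ∞` times, a macroscopic inverse participation ratio is
super-exponentially rare (`stub_noReconcentrationSuperExp`, the hardest stub: degenerate (normal, block)
statistics along `≥ m_N` collisions of `δN` particles).  The union bound of the halves
(`eqSuperExpDelocalisation_of_halves`) and the final assembly are proved here.

Disproof used: no `Disproof.lean` exists for this crux at planning time (nothing to honour); the stubs are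
checked against the negatives index (bounded functionals only — the one-big-jump witness of
`EulerCharacteristicsExpTailBudget_refuted` needs an unbounded weight; thresholds are proper fractions of
`N + 1`, cf. the `ColdIsRare` refutations).
-/

namespace Summit.AtomisticToContinuum.HydrodynamicLimit.Cruxes.DiffuseBackwardInfluence.SuperexpEntropyTransfer

open scoped BigOperators Topology Classical ENNReal
open Filter Set MeasureTheory

noncomputable section

/-! ## Vocabulary (the crux's own `let`s, verbatim, plus the homogeneous law and collision counts) -/

/-- Macroscopic position space `𝕋³`. -/
abbrev T3 : Type := UnitAddTorus (Fin 3)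

/-- Velocity space `ℝ³`. -/
abbrev V3 : Type := EuclideanSpace ℝ (Fin 3)

/-- Phase space of `N + 1` spheres on `𝕋³`. -/
abbrev Cfg (N : ℕ) : Type := Literature.Analysis.FluidPDE.Config (N + 1) (Fin 3) T3

/-- Hard-sphere flows of `N + 1` spheres at reduced density `σ`. -/
abbrev Flow (σ : ℝ) (N : ℕ) : Type :=
  Literature.Analysis.FluidPDE.HardSphereFlow (Literature.Analysis.FluidPDE.Torus.geometry (Fin 3))
    (Literature.MathematicalPhysics.KineticTheory.hsDiameter σ N) (N + 1)

/-- The frozen-geometry velocity transfer over the window `[0, Δ]` started at `y` — VERBATIM the crux's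
`let M` (fold of the linear collision reflections `collidePair` at the realised pre-collisional positions of
the Alexander construction). -/
def transfer (σ : ℝ) (N : ℕ) (y : Cfg N) (Δ : ℝ) (W : Fin (N + 1) → V3) : Fin (N + 1) → V3 :=
  (let G := Literature.Analysis.FluidPDE.Torus.geometry (Fin 3)
   let ε : ℝ := Literature.MathematicalPhysics.KineticTheory.hsDiameter σ N
   let pre := fun k : ℕ => (let zk := Literature.Analysis.FluidPDE.Alexander.stateAfter G ε y k
     Literature.Analysis.FluidPDE.freeFlight G (Literature.Analysis.FluidPDE.Alexander.freeExitTime G ε zk).toReal zk)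
   (List.range (Literature.Analysis.FluidPDE.Alexander.collisionCount G ε y Δ)).foldl
     (fun W' k => @dite (Fin (N + 1) → EuclideanSpace ℝ (Fin 3))
       (Literature.Analysis.FluidPDE.Alexander.incomingPairs G ε (pre k)).Nonempty (Classical.propDecidable _)
       (fun h => fun i => (Literature.Analysis.FluidPDE.collidePair G h.some.1 h.some.2
         (fun j => ((pre k j).1, W' j)) i).2) (fun _ => W')) W)

/-- The mean inverse participation ratio of the rows of the transfer — VERBATIM the crux's `let ipr`
(`∈ [9/(N+1), 9]` by the row budget `Σₖ ‖M_ik‖_F² = 3`, route support item `TransferIsometry`). -/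
def ipr (σ : ℝ) (N : ℕ) (y : Cfg N) (Δ : ℝ) : ℝ :=
  ((N + 1 : ℕ) : ℝ)⁻¹ * ∑ i : Fin (N + 1), ∑ k : Fin (N + 1),
    (∑ a : Fin 3, ‖transfer σ N y Δ (Pi.single k (EuclideanSpace.single a (1 : ℝ))) i‖ ^ 2) ^ 2

/-- The HOMOGENEOUS Gibbs law at rest with temperature `θ`: the local Gibbs law with constant profiles
`(a₀, u₀, θ₀) = (1, 0, θ)` — the invariant reference law of the transfer. -/
def eqLaw (σ θ : ℝ) (N : ℕ) (Φ : Flow σ N) : Measure (Cfg N) :=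
  Literature.MathematicalPhysics.KineticTheory.localGibbsLaw σ (fun _ => 1) (fun _ => 0) (fun _ => θ) N Φ

/-- The number of collisions of particle `i` among the collisions of the Alexander construction started at
`y` that fall in the window `[0, Δ]` (same enumeration `k < collisionCount`, same pre-collisional
configurations `pre k` and same selected incoming pair `h.some` as the fold defining `transfer`). -/
def collOf (σ : ℝ) (N : ℕ) (y : Cfg N) (Δ : ℝ) (i : Fin (N + 1)) : ℕ :=
  (let G := Literature.Analysis.FluidPDE.Torus.geometry (Fin 3)
   let ε : ℝ := Literature.MathematicalPhysics.KineticTheory.hsDiameter σ N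
   let pre := fun k : ℕ => (let zk := Literature.Analysis.FluidPDE.Alexander.stateAfter G ε y k
     Literature.Analysis.FluidPDE.freeFlight G (Literature.Analysis.FluidPDE.Alexander.freeExitTime G ε zk).toReal zk)
   ((Finset.range (Literature.Analysis.FluidPDE.Alexander.collisionCount G ε y Δ)).filter
     (fun k => ∃ h : (Literature.Analysis.FluidPDE.Alexander.incomingPairs G ε (pre k)).Nonempty,
       h.some.1 = i ∨ h.some.2 = i)).card)

/-- The number of particles with AT MOST `m` collisions in the window `[0, Δ]`. -/
def fewCount (σ : ℝ) (N : ℕ) (y : Cfg N) (Δ : ℝ) (m : ℕ) : ℕ :=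
  (Finset.univ.filter (fun i : Fin (N + 1) => collOf σ N y Δ i ≤ m)).card

/-! ## The statements of the line -/

/-- Invariance of the homogeneous Gibbs law at rest under every hard-sphere flow map `Φ_s`, `s ∈ ℝ`
(Liouville invariance `HardSphereFlow.measurePreserving` + kinetic-energy conservation
`IsHardSphereTrajectory.configEnergy_eq` + invariance of the good set ⊆ hard-sphere domain). -/
def EqInvariantAt (σ θ : ℝ) : Prop :=
  ∀ (N : ℕ) (Φ : Flow σ N) (s : ℝ), MeasurePreserving (Φ.flow s) (eqLaw σ θ N Φ) (eqLaw σ θ N Φ)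

/-- `O(N)` relative-entropy budget of the local Gibbs law against the homogeneous law at rest:
`H(P_N | G_N) ≤ C (N+1)` (Mathlib's `InformationTheory.klDiv`; finiteness forces `P_N ≪ G_N` and
integrability of the log-likelihood ratio). -/
def EntropyBudgetAt (σ θ C : ℝ) (a₀ θ₀ : T3 → ℝ) (u₀ : T3 → V3) : Prop :=
  ∀ (N : ℕ) (Φ : Flow σ N),
    InformationTheory.klDiv (Literature.MathematicalPhysics.KineticTheory.localGibbsLaw σ a₀ u₀ θ₀ N Φ)
      (eqLaw σ θ N Φ) ≤ ENNReal.ofReal (C * ((N : ℝ) + 1))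

/-- FEW-COLLISION PARTICLES ARE SUPER-EXPONENTIALLY RARE AT EQUILIBRIUM (ballistic-tubes half): for every
admissible window and every fraction `δ > 0` there is a divergent threshold `m_N → ∞` such that, for every
rate `c`, eventually `G_N{ ≥ δ(N+1) particles have ≤ m_N collisions in [0, Δ_N] } ≤ e^{-c(N+1)}`. -/
def FewCollisionsSuperExpAt (σ θ : ℝ) (Φ : (N : ℕ) → Flow σ N) : Prop :=
  ∀ Δ : ℕ → ℝ, (∀ N, 0 < Δ N) → Tendsto Δ atTop (𝓝 0) →
    Tendsto (fun N : ℕ => Δ N * ((N + 1 : ℕ) : ℝ) ^ ((1 : ℝ) / 3)) atTop atTop →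
    ∀ δ : ℝ, 0 < δ → ∃ m : ℕ → ℕ, Tendsto m atTop atTop ∧ ∀ c : ℝ, 0 < c →
      ∀ᶠ N : ℕ in atTop,
        eqLaw σ θ N (Φ N) {y | δ * ((N : ℝ) + 1) ≤ (fewCount σ N y (Δ N) (m N) : ℝ)} ≤
          ENNReal.ofReal (Real.exp (-(c * ((N : ℝ) + 1))))

/-- NO RECONCENTRATION AT SUPER-EXPONENTIAL PRECISION (the hardest stub): for every admissible window and
`δ > 0` there is a fraction `δ' > 0` such that for EVERY divergent threshold `m_N → ∞` and every rate `c`,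
eventually `G_N{ ipr > δ  and  fewer than δ'(N+1) particles have ≤ m_N collisions } ≤ e^{-c(N+1)}` —
a macroscopic inverse participation ratio carried by particles that all collided `≥ m_N → ∞` times needs
degenerate (normal, block) statistics along their collision sequences, for `≍ δN` particles at once. -/
def NoReconcentrationSuperExpAt (σ θ : ℝ) (Φ : (N : ℕ) → Flow σ N) : Prop :=
  ∀ Δ : ℕ → ℝ, (∀ N, 0 < Δ N) → Tendsto Δ atTop (𝓝 0) →
    Tendsto (fun N : ℕ => Δ N * ((N + 1 : ℕ) : ℝ) ^ ((1 : ℝ) / 3)) atTop atTop →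
    ∀ δ : ℝ, 0 < δ → ∃ δ' : ℝ, 0 < δ' ∧ ∀ m : ℕ → ℕ, Tendsto m atTop atTop → ∀ c : ℝ, 0 < c →
      ∀ᶠ N : ℕ in atTop,
        eqLaw σ θ N (Φ N) {y | δ < ipr σ N y (Δ N) ∧ (fewCount σ N y (Δ N) (m N) : ℝ) < δ' * ((N : ℝ) + 1)} ≤
          ENNReal.ofReal (Real.exp (-(c * ((N : ℝ) + 1))))

/-- EQUILIBRIUM SUPER-EXPONENTIAL DELOCALISATION (the transferred crux `C⁺`, triage sharpening: speed ≫ N,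
no fixed rate): for every admissible window, `δ > 0` and rate `c`, eventually
`G_N{ipr(·, Δ_N) > δ} ≤ e^{-c(N+1)}`. -/
def EqSuperExpDelocalisationAt (σ θ : ℝ) (Φ : (N : ℕ) → Flow σ N) : Prop :=
  ∀ Δ : ℕ → ℝ, (∀ N, 0 < Δ N) → Tendsto Δ atTop (𝓝 0) →
    Tendsto (fun N : ℕ => Δ N * ((N + 1 : ℕ) : ℝ) ^ ((1 : ℝ) / 3)) atTop atTop →
    ∀ δ : ℝ, 0 < δ → ∀ c : ℝ, 0 < c →
      ∀ᶠ N : ℕ in atTop,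
        eqLaw σ θ N (Φ N) {y | δ < ipr σ N y (Δ N)} ≤ ENNReal.ofReal (Real.exp (-(c * ((N : ℝ) + 1))))

/-- The crux's conclusion at fixed `(σ, profiles, flow family)`: for every admissible window and `t > 0`,
`E_{localGibbs}[ipr(Φ_{t-Δ_N} z, Δ_N)] → 0` (literally the tail of `DiffuseBackwardInfluence` after its
`∃ σ₀ ∀ σ < σ₀` prefix, with the `let`s named). -/
def CruxConclusionAt (σ : ℝ) (a₀ θ₀ : T3 → ℝ) (u₀ : T3 → V3) (Φ : (N : ℕ) → Flow σ N) : Prop :=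
  ∀ Δ : ℕ → ℝ, (∀ N, 0 < Δ N) → Tendsto Δ atTop (𝓝 0) →
    Tendsto (fun N : ℕ => Δ N * ((N + 1 : ℕ) : ℝ) ^ ((1 : ℝ) / 3)) atTop atTop →
    ∀ t : ℝ, 0 < t →
      Tendsto (fun N : ℕ => ∫⁻ z, ENNReal.ofReal (ipr σ N ((Φ N).flow (t - Δ N) z) (Δ N))
        ∂(Literature.MathematicalPhysics.KineticTheory.localGibbsLaw σ a₀ u₀ θ₀ N (Φ N))) atTop (𝓝 0)

/-! ## Registered stubs -/

/-- STUB 1 (M, provable-now) — invariance of the homogeneous Gibbs law at rest under the flow, for every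
`0 < σ < 1/2`, `θ > 0`. -/
theorem stub_eqInvariant :
    ∀ σ θ : ℝ, 0 < σ → σ < 1 / 2 → 0 < θ → EqInvariantAt σ θ := by
  sorry

/-- STUB 2 (M) — `O(N)` entropy budget: for continuous positive profiles and `0 < σ < 1/2` there are a
reference temperature `θ > 0` and `C` with `H(localGibbsLaw | eqLaw θ) ≤ C (N+1)` for all `N` and all flows
(Gaussian relative entropies cell by cell + `Z_G / Z_P ≤ (min a₀)^{-(N+1)}`). -/
theorem stub_entropyBudget :
    ∀ (a₀ θ₀ : T3 → ℝ) (u₀ : T3 → V3), Continuous a₀ → Continuous θ₀ → Continuous u₀ →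
      (∀ x, 0 < a₀ x) → (∀ x, 0 < θ₀ x) → ∀ σ : ℝ, 0 < σ → σ < 1 / 2 →
      ∃ θ : ℝ, 0 < θ ∧ ∃ C : ℝ, EntropyBudgetAt σ θ C a₀ θ₀ u₀ := by
  sorry

/-- STUB 3 (L) — few-collision particles are super-exponentially rare under the invariant law
(ballistic tubes: pigeonhole over `m_N + 1` slots + stationarity reduce to a STATIC pairwise tube-separation
event whose Gibbs cost is velocity coherence `≈ 3 (δ/m_N) N log(n_N/m_N)`). -/
theorem stub_fewCollisionsSuperExp :
    ∀ σ θ : ℝ, 0 < σ → σ < 1 / 2 → 0 < θ → ∀ Φ : (N : ℕ) → Flow σ N,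
      FewCollisionsSuperExpAt σ θ Φ := by
  sorry

/-- STUB 4 (XL, hardest) — no reconcentration at super-exponential precision under the invariant law. -/
theorem stub_noReconcentrationSuperExp :
    ∀ σ θ : ℝ, 0 < σ → σ < 1 / 2 → 0 < θ → ∀ Φ : (N : ℕ) → Flow σ N,
      NoReconcentrationSuperExpAt σ θ Φ := by
  sorry

/-- STUB 5 (M) — the ENTROPY TRANSFER: invariance + `O(N)` budget + equilibrium super-exponential
delocalisation ⇒ the crux's conclusion at `(σ, profiles, Φ)`.  Content: `0 ≤ ipr ≤ 9` (row budget,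
`TransferIsometry`), `E_P[ipr ∘ Φ_s] ≤ δ + 9 P(Φ_s⁻¹{ipr > δ})`, the entropy inequality
`P[A] log(1 + 1/G[A]) ≤ 1 + H(P|G)` (from `integral_le_toReal_klDiv_add_integral` with
`g = log(1 + 𝟙_A / G[A])`), `G[Φ_s⁻¹ A'] = G[A']` by invariance, and
`9 (1 + C(N+1)) / log(1 + e^{c(N+1)}) → 9C/c`, then `c → ∞`, `δ → 0`. -/
theorem stub_entropyTransfer :
    ∀ (a₀ θ₀ : T3 → ℝ) (u₀ : T3 → V3), Continuous a₀ → Continuous θ₀ → Continuous u₀ →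
      (∀ x, 0 < a₀ x) → (∀ x, 0 < θ₀ x) → ∀ σ : ℝ, 0 < σ → σ < 1 / 2 → ∀ θ : ℝ, 0 < θ → ∀ C : ℝ,
      ∀ Φ : (N : ℕ) → Flow σ N,
        EqInvariantAt σ θ → EntropyBudgetAt σ θ C a₀ θ₀ u₀ → EqSuperExpDelocalisationAt σ θ Φ →
          CruxConclusionAt σ a₀ θ₀ u₀ Φ := by
  sorry

/-! ## Proved glue -/

/-- Arithmetic of the union bound: `2 e^{-(c+1)(N+1)} ≤ e^{-c(N+1)}` in `ℝ≥0∞`. -/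
theorem two_superexp_le (c : ℝ) (N : ℕ) :
    ENNReal.ofReal (Real.exp (-((c + 1) * ((N : ℝ) + 1)))) +
        ENNReal.ofReal (Real.exp (-((c + 1) * ((N : ℝ) + 1)))) ≤
      ENNReal.ofReal (Real.exp (-(c * ((N : ℝ) + 1)))) := by
  rw [← ENNReal.ofReal_add (Real.exp_pos _).le (Real.exp_pos _).le]
  apply ENNReal.ofReal_le_ofReal
  have hN : (0 : ℝ) ≤ (N : ℝ) := Nat.cast_nonneg N
  have key : Real.exp (-((c + 1) * ((N : ℝ) + 1))) =
      Real.exp (-(c * ((N : ℝ) + 1))) * Real.exp (-((N : ℝ) + 1)) := by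
    rw [← Real.exp_add]
    congr 1
    ring
  rw [key]
  have h1 : Real.exp (-((N : ℝ) + 1)) ≤ Real.exp (-1) := Real.exp_le_exp.mpr (by linarith)
  have h2 : Real.exp (-1 : ℝ) ≤ 1 / 2 := by
    rw [Real.exp_neg, inv_le_comm₀ (Real.exp_pos 1) (by norm_num : (0 : ℝ) < 1 / 2)]
    have := Real.exp_one_gt_d9
    norm_num at this ⊢
    linarith
  have hpos := Real.exp_pos (-(c * ((N : ℝ) + 1)))
  nlinarith [Real.exp_pos (-((N : ℝ) + 1))]

/-- The two halves give the transferred crux `C⁺` (union bound over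
`{ipr > δ} ⊆ {ipr > δ ∧ few < δ'(N+1)} ∪ {few ≥ δ'(N+1)}`, rates `c + 1`). -/
theorem eqSuperExpDelocalisation_of_halves {σ θ : ℝ} {Φ : (N : ℕ) → Flow σ N}
    (hF : FewCollisionsSuperExpAt σ θ Φ) (hR : NoReconcentrationSuperExpAt σ θ Φ) :
    EqSuperExpDelocalisationAt σ θ Φ := by
  intro Δ hΔ hΔ0 hΔ1 δ hδ c hc
  obtain ⟨δ', hδ', hR'⟩ := hR Δ hΔ hΔ0 hΔ1 δ hδ
  obtain ⟨m, hm, hF'⟩ := hF Δ hΔ hΔ0 hΔ1 δ' hδ'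
  have h1 := hR' m hm (c + 1) (by linarith)
  have h2 := hF' (c + 1) (by linarith)
  filter_upwards [h1, h2] with N hN1 hN2
  have hsub : {y : Cfg N | δ < ipr σ N y (Δ N)} ⊆
      {y | δ < ipr σ N y (Δ N) ∧ (fewCount σ N y (Δ N) (m N) : ℝ) < δ' * ((N : ℝ) + 1)} ∪
        {y | δ' * ((N : ℝ) + 1) ≤ (fewCount σ N y (Δ N) (m N) : ℝ)} := by
    intro y hy
    rcases le_or_gt (δ' * ((N : ℝ) + 1)) ((fewCount σ N y (Δ N) (m N) : ℝ)) with h | h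
    · exact Or.inr h
    · exact Or.inl ⟨hy, h⟩
  calc eqLaw σ θ N (Φ N) {y | δ < ipr σ N y (Δ N)}
      ≤ eqLaw σ θ N (Φ N)
          ({y | δ < ipr σ N y (Δ N) ∧ (fewCount σ N y (Δ N) (m N) : ℝ) < δ' * ((N : ℝ) + 1)} ∪
            {y | δ' * ((N : ℝ) + 1) ≤ (fewCount σ N y (Δ N) (m N) : ℝ)}) := measure_mono hsub
    _ ≤ eqLaw σ θ N (Φ N) {y | δ < ipr σ N y (Δ N) ∧ (fewCount σ N y (Δ N) (m N) : ℝ) < δ' * ((N : ℝ) + 1)} +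
          eqLaw σ θ N (Φ N) {y | δ' * ((N : ℝ) + 1) ≤ (fewCount σ N y (Δ N) (m N) : ℝ)} :=
        measure_union_le _ _
    _ ≤ ENNReal.ofReal (Real.exp (-((c + 1) * ((N : ℝ) + 1)))) +
          ENNReal.ofReal (Real.exp (-((c + 1) * ((N : ℝ) + 1)))) := add_le_add hN1 hN2
    _ ≤ ENNReal.ofReal (Real.exp (-(c * ((N : ℝ) + 1)))) := two_superexp_le c N

/-- COMPOSITION (kernel-checked, no sorry): the five stubs imply the crux `DiffuseBackwardInfluence` BY NAME,
with `σ₀ = 1/2`: budget ↦ reference temperature `θ` and constant `C`; invariance at `θ`; the two equilibrium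
halves ↦ `C⁺` by the union bound; the entropy transfer ↦ the crux's conclusion (the crux's `let M, ipr` are
this file's `transfer`, `ipr` verbatim).  STATEMENT-LEVEL form: the five stub STATEMENTS imply the crux's
conclusion at every `0 < σ < 1/2` (no stub is used here; this theorem is sorry-free and axiom-clean). -/
theorem cruxConclusion_of_statements
    (h₁ : ∀ σ θ : ℝ, 0 < σ → σ < 1 / 2 → 0 < θ → EqInvariantAt σ θ)
    (h₂ : ∀ (a₀ θ₀ : T3 → ℝ) (u₀ : T3 → V3), Continuous a₀ → Continuous θ₀ → Continuous u₀ →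
      (∀ x, 0 < a₀ x) → (∀ x, 0 < θ₀ x) → ∀ σ : ℝ, 0 < σ → σ < 1 / 2 →
      ∃ θ : ℝ, 0 < θ ∧ ∃ C : ℝ, EntropyBudgetAt σ θ C a₀ θ₀ u₀)
    (h₃ : ∀ σ θ : ℝ, 0 < σ → σ < 1 / 2 → 0 < θ → ∀ Φ : (N : ℕ) → Flow σ N,
      FewCollisionsSuperExpAt σ θ Φ)
    (h₄ : ∀ σ θ : ℝ, 0 < σ → σ < 1 / 2 → 0 < θ → ∀ Φ : (N : ℕ) → Flow σ N,
      NoReconcentrationSuperExpAt σ θ Φ)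
    (h₅ : ∀ (a₀ θ₀ : T3 → ℝ) (u₀ : T3 → V3), Continuous a₀ → Continuous θ₀ → Continuous u₀ →
      (∀ x, 0 < a₀ x) → (∀ x, 0 < θ₀ x) → ∀ σ : ℝ, 0 < σ → σ < 1 / 2 → ∀ θ : ℝ, 0 < θ → ∀ C : ℝ,
      ∀ Φ : (N : ℕ) → Flow σ N,
        EqInvariantAt σ θ → EntropyBudgetAt σ θ C a₀ θ₀ u₀ → EqSuperExpDelocalisationAt σ θ Φ →
          CruxConclusionAt σ a₀ θ₀ u₀ Φ)
    (a₀ θ₀ : T3 → ℝ) (u₀ : T3 → V3) (ha : Continuous a₀) (hθ : Continuous θ₀) (hu : Continuous u₀)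
    (ha0 : ∀ x, 0 < a₀ x) (hθ0 : ∀ x, 0 < θ₀ x) (σ : ℝ) (hσ : 0 < σ) (hσ2 : σ < 1 / 2)
    (Φ : (N : ℕ) → Flow σ N) : CruxConclusionAt σ a₀ θ₀ u₀ Φ := by
  obtain ⟨θ, hθpos, C, hB⟩ := h₂ a₀ θ₀ u₀ ha hθ hu ha0 hθ0 σ hσ hσ2
  have hI : EqInvariantAt σ θ := h₁ σ θ hσ hσ2 hθpos
  have hD : EqSuperExpDelocalisationAt σ θ Φ :=
    eqSuperExpDelocalisation_of_halves (h₃ σ θ hσ hσ2 hθpos Φ) (h₄ σ θ hσ hσ2 hθpos Φ)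
  exact h₅ a₀ θ₀ u₀ ha hθ hu ha0 hθ0 σ hσ hσ2 θ hθpos C Φ hI hB hD

/-- THE SKELETON THEOREM (audit shape A12: concludes the crux decl BY NAME, no hypotheses; `sorry` lives only in
the five registered stubs it invokes — once they are proved this very theorem IS the crux proof).  `σ₀ = 1/2`;
the crux's `let M, ipr` ζ-reduce to this file's `transfer`, `ipr` (closed by `exact`). -/
theorem DiffuseBackwardInfluence_of :
    Summit.AtomisticToContinuum.HydrodynamicLimit.Theses.CollisionIsometryCLT.DiffuseBackwardInfluence := by
  intro a₀ θ₀ u₀ ha hθ hu ha0 hθ0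
  refine ⟨1 / 2, by norm_num, ?_⟩
  intro σ hσ hσ2 M ipr' Φ Δ hΔ hΔ0 hΔ1 t ht
  exact cruxConclusion_of_statements stub_eqInvariant stub_entropyBudget stub_fewCollisionsSuperExp
    stub_noReconcentrationSuperExp stub_entropyTransfer a₀ θ₀ u₀ ha hθ hu ha0 hθ0 σ hσ hσ2 Φ Δ hΔ hΔ0 hΔ1 t ht

end

end Summit.AtomisticToContinuum.HydrodynamicLimit.Cruxes.DiffuseBackwardInfluence.SuperexpEntropyTransfer
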